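import Summits.CriticalPhenomena.PercolationContinuityZ3.Theorems.Transplant.PlanarSkeletonFrmQuasiDefs
import Summits.CriticalPhenomena.PercolationContinuityZ3.Theorems.Transplant.SkelFrmQuasiBChoiceNums
import Summits.CriticalPhenomena.PercolationContinuityZ3.Theorems.Transplant.SkelFrmBChoiceNums
import Summits.CriticalPhenomena.PercolationContinuityZ3.Theorems.Transplant.SkelFrmQuasiBParamsFaceRoomsA
import Summits.CriticalPhenomena.PercolationContinuityZ3.Theorems.Transplant.SkelFrmBParamsFaceRoomsA
import Summits.CriticalPhenomena.PercolationContinuityZ3.Theorems.Transplant.SkelFrmQuasi1ChoiceDefs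
import Summits.CriticalPhenomena.PercolationContinuityZ3.Theorems.Transplant.SkelFrmQuasi1ParamsLBL
import Summits.CriticalPhenomena.PercolationContinuityZ3.Theorems.Transplant.SkelFrmQuasi1ParamsPO
import Summits.CriticalPhenomena.PercolationContinuityZ3.Theorems.Transplant.SkelFrmQuasiBParamsLF
import Summits.CriticalPhenomena.PercolationContinuityZ3.Theorems.Transplant.SkelFrmQuasiBParamsLFA
import Summits.CriticalPhenomena.PercolationContinuityZ3.Theorems.Transplant.SkelFrmQuasiBParamsSlotsTA
import Summits.CriticalPhenomena.PercolationContinuityZ3.Theorems.Transplant.SkelFrmQuasi1SlotTypes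
import HarnessLib
import Summits.CriticalPhenomena.PercolationContinuityZ3.Theorems.Transplant.SkelFrmBParamsFaceRoomsAR0
/-!
# GEN-Q PORT (WAVE-Q table v0.8 section 2, row G137, U-level L16; captain R-6/R-7 2026-08-27: carrier token swap `PlanarSkeletonFrmFrom ↦ PlanarSkeletonFrmQuasi`)
# of the tree module «Transplant/SkelFrmFromBParamsFaceRoomsAR0» (sha256 09097870df06b1a1…) onto the quasi-step carrier `PlanarSkeletonFrmQuasi` (p507026): «SkelFrmQuasiBParamsFaceRoomsAR0»

HAND HUNK (L-FLOORMAP-1 ①⑥ / L-KitS-1 reader side; G017 «SkelFrmQuasiBChoiceNums», hp-8's KitSN): KS0.R'0→KS0.R'0N×5, KS0.Rlev0→KS0.Rlev0N×4, KS0.R'0_eq→KS0.R'0N_eq×1 — the kit of record at window cost `KS.NQ Φ`.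

ORIGINAL TITLE: N2 (frames-only node `SamePDropOfSkeletonFrmFrom₁`, OPEN) params column over `PlanarSkeletonFrm` — (F) value layer, **J19 / R0 SUCCESSOR of

builds on p205010 (kernel theorem, internal audit signed; external expert review pending) — nothing in this file uses p205010; NOTHING is claimed about any open node
((N3-b), the end state).  Lane `prim-bschramm`, seat `prim-bschramm-stmt` (gen 33; GEN-Q column pen; tool = captain gen-1 g4's port_genq.py R-14 --cone + p3-g30's T1 patch).  Helper file (`--supports stmt-CriticalPhenomena-4575 --as helper`).
PORT RULES (U-wave r1–r4 re-used, GEN-Q hunk classes of p3-g29 #6136): declaration order, names and proof texts are those of «SkelFrmFromBParamsFaceRoomsAR0», byte-identical except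
(i) the carrier token `PlanarSkeletonFrmFrom ↦ PlanarSkeletonFrmQuasi` in binders, `namespace`/`end` lines and qualified names (module names `SkelFrmFrom… ↦ SkelFrmQuasi…`
in imports of already-ported rows); (ii) `Φ.step ↦ Φ.qstep` with the called Steps lemma replaced by its `…Q`/`_q` twin and the cost `Φ.M` threaded (none in this file unless
listed below); (iii) `Φ.cyl_connected ↦ Φ.cyl_reach` readers (none unless listed); (iv) graph-ball radii / window floors ×`Φ.M` (none unless listed).  Carrier-free
residents stay imported/exported from the original «SkelFrmBParamsFaceRoomsAR0» exactly as in the FrmFrom port.  Docstrings and citations are the original's.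

-/

noncomputable section

open scoped Classical

namespace Summit.CriticalPhenomena.PercolationContinuityZ3.Theorems.Transplant

namespace PlanarSkeletonFrmQuasi

namespace NegB

open Literature.Probability.Percolation Literature.Probability.LatticeModels SimpleGraph
open Literature.Probability.Percolation.KozmaNitzan.Cells (oth)
open SkelConc (Consts)
open Skelφ.StepI (DataN)
open Neg

/-! ## Levels vs cells at the (S0) kit (at `g := KS.gT mk gx`) -/

section Rooms

-- GEN-Q (R-2, captain 2026-08-27): `PlanarSkeletonFrmFrom.NegB.Rlev0_le_R'0` is not in the used cone of the node top — not ported.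

/-- **Levels of the (S0) kit vs the (ζ′) cells** at `g := gT`, axis `i`, under the stride floor `hsR0 : 6·R'0 + 11 ≤ s_i` (J19 floor-as-hypothesis):
`Rlev0 + 4 ≤ 10·s_i` and `Rlev0 + 4 ≤ 3·r_i` (hp-8's `hRlev/hRlev'`; `R′0 = Rlev0 + 1`, `r_i = K·s_i`, `K ≥ 40`) — the R′0 successor of `hRlev_RA`. [folklore] -/
theorem hRlev_R0 (κ : Consts) {V : Type} [DecidableEq V] [Countable V] {G : SimpleGraph V} [G.LocallyFinite] (Φ : PlanarSkeletonFrmQuasi G) (t : V) (p : unitInterval) (D : Skelφ.StepI.DataNS V) (f : ℕ) (mk : ℕ) (gx : Neg.FSlot)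
    (i : Fin 2) (hsR0 : 6 * (KS0.R'0N κ Φ (KS.NQ Φ) t p D mk : ℤ) + 11 ≤ (((fcellsA κ Φ t p D (KS.gT mk gx κ Φ t p D) f).s i : ℕ) : ℤ)) :
    KS0.Rlev0N κ Φ (KS.NQ Φ) t p D mk + 4 ≤ 10 * (fcellsA κ Φ t p D (KS.gT mk gx κ Φ t p D) f).s i ∧ KS0.Rlev0N κ Φ (KS.NQ Φ) t p D mk + 4 ≤ 3 * (fcellsA κ Φ t p D (KS.gT mk gx κ Φ t p D) f).r i := by
  have hR := (KS0.R'0N_eq κ Φ (KS.NQ Φ) t p D mk).2.1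
  have hr := (fcellsA_K κ Φ t p D (KS.gT mk gx κ Φ t p D) f).2.2 i
  have hK := (Neg.forty_le_K κ).1
  have hs : KS0.R'0N κ Φ (KS.NQ Φ) t p D mk + 3 ≤ (fcellsA κ Φ t p D (KS.gT mk gx κ Φ t p D) f).s i := by
    have : ((KS0.R'0N κ Φ (KS.NQ Φ) t p D mk : ℕ) : ℤ) + 3 ≤ (((fcellsA κ Φ t p D (KS.gT mk gx κ Φ t p D) f).s i : ℕ) : ℤ) := by linarith
    exact_mod_cast this
  constructor
  · omega
  · rw [hr]; nlinarith

/-- **Levels vs cells from the BOX FLOOR** `hMR0 : 4·K·(R'0+2) ≤ M_L (gT mk gx)`, both axes (`KS.sA_ge_of_floor'`). [folklore] -/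
theorem hRlev_R0_of_box (κ : Consts) {V : Type} [DecidableEq V] [Countable V] {G : SimpleGraph V} [G.LocallyFinite] (Φ : PlanarSkeletonFrmQuasi G) (t : V) (p : unitInterval) (D : Skelφ.StepI.DataNS V) (f : ℕ) (mk : ℕ) (gx : Neg.FSlot) (hN : EqNumL κ Φ t p D (KS.gT mk gx κ Φ t p D) f) (hκ : (hL κ Φ t p D (KS.gT mk gx κ Φ t p D) f).natAbs ≤ 10 * nL κ Φ t p D (KS.gT mk gx κ Φ t p D) f)
    (hMR0 : 4 * Neg.K κ * (KS0.R'0N κ Φ (KS.NQ Φ) t p D mk + 2) ≤ ML κ Φ t p D (KS.gT mk gx κ Φ t p D)) (i : Fin 2) :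
    KS0.Rlev0N κ Φ (KS.NQ Φ) t p D mk + 4 ≤ 10 * (fcellsA κ Φ t p D (KS.gT mk gx κ Φ t p D) f).s i ∧ KS0.Rlev0N κ Φ (KS.NQ Φ) t p D mk + 4 ≤ 3 * (fcellsA κ Φ t p D (KS.gT mk gx κ Φ t p D) f).r i := by
  obtain ⟨h0, h1⟩ := KS.sA_ge_of_floor' κ Φ t p D (KS.gT mk gx κ Φ t p D) f hN hκ hMR0
  have hR : (0 : ℤ) ≤ (KS0.R'0N κ Φ (KS.NQ Φ) t p D mk : ℤ) := Nat.cast_nonneg _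
  refine hRlev_R0 κ Φ t p D f mk gx i ?_
  obtain rfl | rfl : i = 0 ∨ i = 1 := by fin_cases i <;> simp
  · exact h0
  · linarith

end Rooms

end NegB

end PlanarSkeletonFrmQuasi

end Summit.CriticalPhenomena.PercolationContinuityZ3.Theorems.Transplant

end
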